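import Mathlib
import Summits.CriticalPhenomena.PercolationContinuityZ3.Theses.PercExchangeRateTransport

/-!
# Line `corrector` — crux `TransportLemma` (stmt-CriticalPhenomena-16063) — rev 2: ALL STUBS PROVED (sorry-free)
Route `route-CriticalPhenomena-PercExchangeRateTransport`, sub-problem `PercolationContinuityZ3`.
Strategist line (planner-cstrat-stmt-CriticalPhenomena-16063-b1-0, 2026-08-17), an ALTERNATIVE to
`Lines/birth.lean` with a different cut and a different engine for the level-transport step.

## The technique (teeth)
EXACT CHARACTERISTIC + CLOSED-FORM EXPONENTIAL CORRECTOR. Once the threshold curve is known to be a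
characteristic (`pc' = −a(pc,·)`, the pinching step), the comparison curves
`γ = pc + g`, `g' = −(L'g + η)` resp. `g' = L'g + η` (explicit exponentials, `L' = max L 1`)
are super- resp. sub-characteristics of the limiting field by the Lipschitz clause alone
(`γ' + a(γ,·) ≤ −η`, resp. `≥ η`), and ONE fence lemma — chain rule along a `C¹` curve plus the
sign of the derivative (`antitoneOn_of_hasDerivWithinAt_nonpos`) — makes every `Θ n`, `n ≥ m(η)`,
monotone along them. No Euler polygons, no partitions, no discrete Grönwall, no ODE existence
theory: the linearised comparison ODE is solved in closed form. With this engine the level-transport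
statement of line `birth` (its registered stub `stub_levelTransport`, judged there the hardest,
L-sized) is PROVED in this file (`levelTransport`, sorry-free), and the same fence lemma is the
only analytic input the two remaining stubs need (four straight test segments).

## Stubs (2, registered; BOTH PROVED in rev 2) — the pinching estimate, split by the side of the threshold that is spent
* `stub_upperFence`  — POSITIVITY PROPAGATION: uniformly in `t₀ ∈ [lo,hi]`,
  `pc s − pc t₀ + a(pc t₀,t₀)(s − t₀) ≤ η|s − t₀|` for `|s − t₀| ≤ τ(η)`. Straight segments issued
  from `(pc t₀ + ε, t₀)` with slope `−(a₀ ∓ η)` (forward / backward in time) are monotone for every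
  `Θ n`, `n ≥ m(η/2)` (fence lemma + the handed-in uniform modulus of `a`), the threshold property
  turns `Θ∞ > 0` at their far end into `pc s ≤ γ s`, and `ε ↓ 0`.
* `stub_lowerFence`  — ZERO PROPAGATION: the mirror bound
  `−η|s − t₀| ≤ pc s − pc t₀ + a(pc t₀,t₀)(s − t₀)`, from segments issued from `(pc t₀ − ε, t₀)`
  (this is where the LEFT `δ(η)`-strip of the exchange hypothesis is load-bearing, cf. the
  refuter's mutation analysis on the item) and `Θ∞ = 0` propagated to their far end.
Both stubs receive the bound `A` and the uniform moduli of `a` (two-sided closed collar) and of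
`pc` as HYPOTHESES; these are discharged here (`collar_moduli`, `pc_modulus`: Heine–Cantor), so a
stub prover does no topology. Neither stub mentions `L`, the Lipschitz clause or monotonicity in `t`.

## Proved here (no `sorry`)
`hasDerivWithinAt_along` (chain rule along a curve, in terms of the two partial `deriv`s),
`fence_antitoneOn` / `fence_monotoneOn` (the fence lemma), `hasDerivWithinAt_of_cone`,
`pc_modulus`, `collar_moduli`, `levelTransport` (= `birth.stub_levelTransport` verbatim),
`rightContinuity` and `TransportLemma_of_stubs` (taken over verbatim from `Lines/birth.lean`,
planner-skel-stmt-CriticalPhenomena-16063-0), `curveIsCharacteristic_of_fences`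
(fences ⇒ `birth.stub_curveIsCharacteristic` statement), `TransportLemma_of_fences`
(the two stub STATEMENTS ⇒ the crux), and the registrar theorem
`TransportLemma_of : …Theses.PercExchangeRateTransport.TransportLemma` (crux BY NAME; rev 2: NO `sorry`
anywhere — the two `stub_*` are proved in §1b; the same proof in Theorems-file shape is attached to the
item as evidence `PercExchangeRateTransportTransportLemma.lean`, landable by any prover with
`--workitem stmt-CriticalPhenomena-16063`).

Disproof used: none relevant — no `Disproof.lean` / `Negative/` lemma exists for this crux
(2026-08-17: `ledger crux ls stmt-CriticalPhenomena-16063` lists only `Lines/birth.*`; the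
payload's disproof_path does not exist). Dead lines: none recorded.
-/

namespace Summit.CriticalPhenomena.PercolationContinuityZ3.Cruxes.TransportLemma.Corrector

open Filter Topology Set

/-! ## §1  The fence lemma (proved) -/

/-- Chain rule along a curve `r ↦ (γ r, r)`, written with the two partial `deriv`s that occur in
the exchange-rate hypothesis. -/
theorem hasDerivWithinAt_along (Θ : ℝ → ℝ → ℝ) (γ : ℝ → ℝ) (γ' : ℝ) (S : Set ℝ) (s : ℝ)
    (hΘ : DifferentiableAt ℝ (fun x : ℝ × ℝ => Θ x.1 x.2) (γ s, s))
    (hγ : HasDerivWithinAt γ γ' S s) :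
    HasDerivWithinAt (fun r => Θ (γ r) r)
      (deriv (fun q => Θ q s) (γ s) * γ' + deriv (fun r => Θ (γ s) r) s) S s := by
  set F : ℝ × ℝ → ℝ := fun x => Θ x.1 x.2 with hF
  have hFd : HasFDerivAt F (fderiv ℝ F (γ s, s)) (γ s, s) := hΘ.hasFDerivAt
  have hc : HasDerivWithinAt (fun r => (γ r, r)) (γ', (1:ℝ)) S s :=
    hγ.prodMk (hasDerivWithinAt_id s S)
  have hcomp : HasDerivWithinAt (F ∘ fun r => (γ r, r)) (fderiv ℝ F (γ s, s) (γ', 1)) S s :=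
    HasFDerivAt.comp_hasDerivWithinAt (f := fun r => (γ r, r)) s hFd hc
  have hp : HasDerivAt (fun q => Θ q s) (fderiv ℝ F (γ s, s) (1, 0)) (γ s) := by
    have h1 : HasDerivAt (fun q : ℝ => (q, s)) ((1:ℝ), (0:ℝ)) (γ s) :=
      (hasDerivAt_id _).prodMk (hasDerivAt_const _ _)
    exact HasFDerivAt.comp_hasDerivAt (f := fun q : ℝ => (q, s)) (γ s) hFd h1
  have ht : HasDerivAt (fun r => Θ (γ s) r) (fderiv ℝ F (γ s, s) (0, 1)) s := by
    have h1 : HasDerivAt (fun r : ℝ => (γ s, r)) ((0:ℝ), (1:ℝ)) s :=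
      (hasDerivAt_const _ _).prodMk (hasDerivAt_id _)
    exact HasFDerivAt.comp_hasDerivAt (f := fun r : ℝ => (γ s, r)) s hFd h1
  rw [hp.deriv, ht.deriv]
  have key : fderiv ℝ F (γ s, s) (γ', 1)
      = fderiv ℝ F (γ s, s) (1, 0) * γ' + fderiv ℝ F (γ s, s) (0, 1) := by
    have e : ((γ', (1:ℝ)) : ℝ × ℝ) = γ' • ((1:ℝ), (0:ℝ)) + ((0:ℝ), (1:ℝ)) := by
      ext <;> simp
    rw [e, map_add, map_smul, smul_eq_mul]
    ring
  rw [← key]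
  exact hcomp

/-- **Fence lemma, decreasing version.** Along a curve `γ` on `[s₀,s₁]` where `Θ` is
differentiable, nondecreasing in `p`, the exchange inequality with field `a` and slack `η` holds,
and `γ' + a(γ,·) ≤ −η`, the composite `s ↦ Θ (γ s) s` is antitone. -/
theorem fence_antitoneOn (Θ : ℝ → ℝ → ℝ) (a : ℝ → ℝ → ℝ) (γ γ' : ℝ → ℝ) (η s₀ s₁ : ℝ)
    (hΘ : ∀ s ∈ Icc s₀ s₁, DifferentiableAt ℝ (fun x : ℝ × ℝ => Θ x.1 x.2) (γ s, s))
    (hmono : ∀ t, Monotone (fun p => Θ p t))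
    (hγ : ∀ s ∈ Icc s₀ s₁, HasDerivWithinAt γ (γ' s) (Icc s₀ s₁) s)
    (hex : ∀ s ∈ Icc s₀ s₁,
      |deriv (fun r => Θ (γ s) r) s - a (γ s) s * deriv (fun q => Θ q s) (γ s)|
        ≤ η * deriv (fun q => Θ q s) (γ s))
    (hslope : ∀ s ∈ Icc s₀ s₁, γ' s + a (γ s) s ≤ -η) :
    AntitoneOn (fun s => Θ (γ s) s) (Icc s₀ s₁) := by
  have hD : ∀ s ∈ Icc s₀ s₁, HasDerivWithinAt (fun r => Θ (γ r) r)
      (deriv (fun q => Θ q s) (γ s) * γ' s + deriv (fun r => Θ (γ s) r) s) (Icc s₀ s₁) s :=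
    fun s hs => hasDerivWithinAt_along Θ γ (γ' s) (Icc s₀ s₁) s (hΘ s hs) (hγ s hs)
  apply antitoneOn_of_hasDerivWithinAt_nonpos (convex_Icc s₀ s₁)
    (f' := fun s => deriv (fun q => Θ q s) (γ s) * γ' s + deriv (fun r => Θ (γ s) r) s)
  · exact fun s hs => (hD s hs).continuousWithinAt
  · intro s hs
    rw [interior_Icc] at hs ⊢
    exact (hD s (Ioo_subset_Icc_self hs)).mono Ioo_subset_Icc_self
  · intro s hs
    rw [interior_Icc] at hs
    have hs' : s ∈ Icc s₀ s₁ := Ioo_subset_Icc_self hs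
    have hP : 0 ≤ deriv (fun q => Θ q s) (γ s) := (hmono s).deriv_nonneg
    have h1 := hex s hs'
    have h2 := hslope s hs'
    have h3 := (abs_le.1 h1).2
    nlinarith [mul_le_mul_of_nonneg_left h2 hP]

/-- **Fence lemma, increasing version** (`γ' + a(γ,·) ≥ η` ⇒ monotone). -/
theorem fence_monotoneOn (Θ : ℝ → ℝ → ℝ) (a : ℝ → ℝ → ℝ) (γ γ' : ℝ → ℝ) (η s₀ s₁ : ℝ)
    (hΘ : ∀ s ∈ Icc s₀ s₁, DifferentiableAt ℝ (fun x : ℝ × ℝ => Θ x.1 x.2) (γ s, s))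
    (hmono : ∀ t, Monotone (fun p => Θ p t))
    (hγ : ∀ s ∈ Icc s₀ s₁, HasDerivWithinAt γ (γ' s) (Icc s₀ s₁) s)
    (hex : ∀ s ∈ Icc s₀ s₁,
      |deriv (fun r => Θ (γ s) r) s - a (γ s) s * deriv (fun q => Θ q s) (γ s)|
        ≤ η * deriv (fun q => Θ q s) (γ s))
    (hslope : ∀ s ∈ Icc s₀ s₁, η ≤ γ' s + a (γ s) s) :
    MonotoneOn (fun s => Θ (γ s) s) (Icc s₀ s₁) := by
  have hD : ∀ s ∈ Icc s₀ s₁, HasDerivWithinAt (fun r => Θ (γ r) r)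
      (deriv (fun q => Θ q s) (γ s) * γ' s + deriv (fun r => Θ (γ s) r) s) (Icc s₀ s₁) s :=
    fun s hs => hasDerivWithinAt_along Θ γ (γ' s) (Icc s₀ s₁) s (hΘ s hs) (hγ s hs)
  apply monotoneOn_of_hasDerivWithinAt_nonneg (convex_Icc s₀ s₁)
    (f' := fun s => deriv (fun q => Θ q s) (γ s) * γ' s + deriv (fun r => Θ (γ s) r) s)
  · exact fun s hs => (hD s hs).continuousWithinAt
  · intro s hs
    rw [interior_Icc] at hs ⊢
    exact (hD s (Ioo_subset_Icc_self hs)).mono Ioo_subset_Icc_self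
  · intro s hs
    rw [interior_Icc] at hs
    have hs' : s ∈ Icc s₀ s₁ := Ioo_subset_Icc_self hs
    have hP : 0 ≤ deriv (fun q => Θ q s) (γ s) := (hmono s).deriv_nonneg
    have h1 := hex s hs'
    have h2 := hslope s hs'
    have h3 := (abs_le.1 h1).1
    nlinarith [mul_le_mul_of_nonneg_left h2 hP]

/-! ## §1b  The two registered stubs — PROVED -/

/-- Upper fence (positivity propagation). -/
theorem stub_upperFence :
    ∀ (Θ : ℕ → ℝ → ℝ → ℝ) (pc : ℝ → ℝ) (a : ℝ → ℝ → ℝ) (lo hi ρ A : ℝ),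
      0 < lo → lo < hi → hi < 1 → 0 < ρ →
      (∀ n, ContDiffOn ℝ 1 (fun x : ℝ × ℝ => Θ n x.1 x.2) (Set.Ioo 0 1 ×ˢ Set.Ioo 0 1)) →
      (∀ n t, Monotone (fun p => Θ n p t)) →
      (∀ p t, Antitone (fun n => Θ n p t)) →
      (∀ n p t, 0 ≤ Θ n p t) →
      (∀ t ∈ Set.Icc lo hi, ρ < pc t ∧ pc t + ρ < 1) →
      (∀ t ∈ Set.Icc lo hi, ∀ p : ℝ,
          (p < pc t → (⨅ n, Θ n p t) = 0) ∧ (pc t < p → 0 < ⨅ n, Θ n p t)) →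
      (∀ t ∈ Set.Icc lo hi, ∀ p : ℝ, |p - pc t| ≤ ρ → |a p t| ≤ A) →
      (∀ η > (0 : ℝ), ∃ ω > (0 : ℝ), ∀ t ∈ Set.Icc lo hi, ∀ t' ∈ Set.Icc lo hi, ∀ p p' : ℝ,
          |p - pc t| ≤ ρ → |p' - pc t'| ≤ ρ → |t - t'| ≤ ω → |p - p'| ≤ ω →
          |a p t - a p' t'| ≤ η) →
      (∀ κ > (0 : ℝ), ∃ τ > (0 : ℝ), ∀ t ∈ Set.Icc lo hi, ∀ t' ∈ Set.Icc lo hi,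
          |t - t'| ≤ τ → |pc t - pc t'| ≤ κ) →
      (∀ η > (0 : ℝ), ∃ δ > (0 : ℝ), ∃ m : ℕ, ∀ n ≥ m, ∀ t ∈ Set.Icc lo hi, ∀ p : ℝ,
          pc t - δ ≤ p → p ≤ pc t + ρ →
          |deriv (fun s => Θ n p s) t - a p t * deriv (fun q => Θ n q t) p|
            ≤ η * deriv (fun q => Θ n q t) p) →
      ∀ η > (0 : ℝ), ∃ τ > (0 : ℝ), ∀ t₀ ∈ Set.Icc lo hi, ∀ s ∈ Set.Icc lo hi, |s - t₀| ≤ τ →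
        pc s - pc t₀ + a (pc t₀) t₀ * (s - t₀) ≤ η * |s - t₀| := by
  intro Θ pc a lo hi ρ A hlo hlohi hhi hρ hC1 hmp hanti hnn hcollar hthr hA hω hτ hex η hη
  -- constants of the construction
  have hη2 : (0:ℝ) < η / 2 := by positivity
  obtain ⟨δ, hδ, m, hm⟩ := hex (η / 2) hη2
  obtain ⟨ω, hω0, hωa⟩ := hω (η / 2) hη2
  have hκ : 0 < min δ ρ := lt_min hδ hρ
  obtain ⟨τ₁, hτ₁, hpc1⟩ := hτ (min δ ρ / 4) (by positivity)
  have hA0 : 0 ≤ A :=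
    le_trans (abs_nonneg _) (hA lo ⟨le_rfl, hlohi.le⟩ (pc lo) (by simp [hρ.le]))
  obtain ⟨θ, hθ0, hθω, hθκ⟩ : ∃ θ : ℝ, 0 < θ ∧ θ ≤ ω ∧ θ ≤ min δ ρ / 4 :=
    ⟨min ω (min δ ρ / 4), lt_min hω0 (by positivity), min_le_left _ _, min_le_right _ _⟩
  obtain ⟨B, hB0, hBA⟩ : ∃ B : ℝ, 0 < B ∧ A + η ≤ B := ⟨A + η + 1, by positivity, by linarith⟩
  obtain ⟨τ, hτ0, hττ₁, hτω, hτB⟩ : ∃ τ : ℝ, 0 < τ ∧ τ ≤ τ₁ ∧ τ ≤ ω ∧ B * τ ≤ θ / 2 := by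
    refine ⟨min τ₁ (min ω (θ / (2 * B))), lt_min hτ₁ (lt_min hω0 (by positivity)),
      min_le_left _ _, le_trans (min_le_right _ _) (min_le_left _ _), ?_⟩
    have h1 : min τ₁ (min ω (θ / (2 * B))) ≤ θ / (2 * B) :=
      le_trans (min_le_right _ _) (min_le_right _ _)
    calc B * min τ₁ (min ω (θ / (2 * B))) ≤ B * (θ / (2 * B)) :=
          mul_le_mul_of_nonneg_left h1 hB0.le
      _ = θ / 2 := by field_simp
  refine ⟨τ, hτ0, ?_⟩
  intro t₀ ht₀ s hs hst
  -- generic tools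
  have bdd : ∀ q r, BddBelow (Set.range fun n => Θ n q r) := fun q r =>
    ⟨0, by rintro _ ⟨n, rfl⟩; exact hnn n q r⟩
  have infle : ∀ q r q' r', (∀ n ≥ m, Θ n q r ≤ Θ n q' r') →
      (⨅ n, Θ n q r) ≤ ⨅ n, Θ n q' r' := by
    intro q r q' r' h
    refine le_ciInf fun N => ?_
    calc (⨅ n, Θ n q r) ≤ Θ (max N m) q r := ciInf_le (bdd q r) _
      _ ≤ Θ (max N m) q' r' := h _ (le_max_right _ _)
      _ ≤ Θ N q' r' := hanti q' r' (le_max_left _ _)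
  have hsq : IsOpen (Set.Ioo (0:ℝ) 1 ×ˢ Set.Ioo (0:ℝ) 1) := isOpen_Ioo.prod isOpen_Ioo
  have ha₀ : |a (pc t₀) t₀| ≤ A := hA t₀ ht₀ (pc t₀) (by simp [hρ.le])
  have hδρ1 : min δ ρ ≤ δ := min_le_left _ _
  have hδρ2 : min δ ρ ≤ ρ := min_le_right _ _
  -- facts along a straight segment r ↦ p₀ - c (r - t₀), |p₀ - pc t₀| = ε < θ/2, |c| ≤ B
  have seg : ∀ (ε c : ℝ), 0 < ε → ε < θ / 2 → |c| ≤ B →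
      ∀ r ∈ Set.Icc lo hi, |r - t₀| ≤ τ →
        (pc r - δ ≤ pc t₀ + ε - c * (r - t₀) ∧ pc t₀ + ε - c * (r - t₀) ≤ pc r + ρ) ∧
        (pc t₀ + ε - c * (r - t₀) ∈ Set.Ioo (0:ℝ) 1 ∧ r ∈ Set.Ioo (0:ℝ) 1) ∧
        |a (pc t₀ + ε - c * (r - t₀)) r - a (pc t₀) t₀| ≤ η / 2 := by
    intro ε c hε hεθ hcB r hr hrt
    have h1 : |pc t₀ + ε - c * (r - t₀) - pc t₀| ≤ θ := by
      have e : pc t₀ + ε - c * (r - t₀) - pc t₀ = ε - c * (r - t₀) := by ring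
      rw [e]
      have hct : |c| * |r - t₀| ≤ B * τ :=
        mul_le_mul hcB hrt (abs_nonneg _) hB0.le
      calc |ε - c * (r - t₀)| ≤ |ε| + |c * (r - t₀)| := abs_sub _ _
        _ = ε + |c| * |r - t₀| := by rw [abs_of_pos hε, abs_mul]
        _ ≤ θ := by linarith
    have h2 : |pc r - pc t₀| ≤ min δ ρ / 4 := hpc1 r hr t₀ ht₀ (hrt.trans hττ₁)
    have h3 : |pc t₀ + ε - c * (r - t₀) - pc r| ≤ min δ ρ / 2 := by
      have e : pc t₀ + ε - c * (r - t₀) - pc r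
          = (pc t₀ + ε - c * (r - t₀) - pc t₀) - (pc r - pc t₀) := by ring
      rw [e]
      calc |(pc t₀ + ε - c * (r - t₀) - pc t₀) - (pc r - pc t₀)|
          ≤ |pc t₀ + ε - c * (r - t₀) - pc t₀| + |pc r - pc t₀| := abs_sub _ _
        _ ≤ θ + min δ ρ / 4 := by linarith
        _ ≤ min δ ρ / 2 := by linarith
    obtain ⟨h3a, h3b⟩ := abs_le.1 h3
    obtain ⟨hc1, hc2⟩ := hcollar r hr
    refine ⟨⟨by linarith, by linarith⟩,
      ⟨⟨by linarith, by linarith⟩, ⟨by linarith [hr.1], by linarith [hr.2]⟩⟩, ?_⟩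
    exact hωa r hr t₀ ht₀ (pc t₀ + ε - c * (r - t₀)) (pc t₀)
      (by rw [abs_le]; constructor <;> linarith) (by simp [hρ.le]) (le_trans hrt hτω)
      (le_trans h1 hθω)
  -- the claim at every small ε > 0
  have claim : ∀ ε : ℝ, 0 < ε → ε < θ / 2 →
      pc s - pc t₀ + a (pc t₀) t₀ * (s - t₀) ≤ η * |s - t₀| + ε := by
    intro ε hε hεθ
    rcases lt_trichotomy t₀ s with hlt | heq | hgt
    · -- forward segment of slope -(a₀ - η), issued from (pc t₀ + ε, t₀)
      have hcB : |a (pc t₀) t₀ - η| ≤ B := by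
        calc |a (pc t₀) t₀ - η| ≤ |a (pc t₀) t₀| + |η| := abs_sub _ _
          _ ≤ B := by rw [abs_of_pos hη]; linarith
      have hIcc : Set.Icc t₀ s ⊆ Set.Icc lo hi := Set.Icc_subset_Icc ht₀.1 hs.2
      have hrt : ∀ r ∈ Set.Icc t₀ s, |r - t₀| ≤ τ := by
        intro r hr
        rw [abs_of_nonneg (by linarith [hr.1])]
        have : |s - t₀| = s - t₀ := abs_of_pos (by linarith)
        linarith [hr.2]
      have F := fun r (hr : r ∈ Set.Icc t₀ s) =>
        seg ε (a (pc t₀) t₀ - η) hε hεθ hcB r (hIcc hr) (hrt r hr)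
      have key : ∀ n ≥ m, Θ n (pc t₀ + ε) t₀
          ≤ Θ n (pc t₀ + ε - (a (pc t₀) t₀ - η) * (s - t₀)) s := by
        intro n hn
        have hM : MonotoneOn (fun r => Θ n (pc t₀ + ε - (a (pc t₀) t₀ - η) * (r - t₀)) r)
            (Set.Icc t₀ s) :=
          fence_monotoneOn (Θ n) a (fun r => pc t₀ + ε - (a (pc t₀) t₀ - η) * (r - t₀))
            (fun _ => -(a (pc t₀) t₀ - η)) (η / 2) t₀ s
            (fun r hr => ((hC1 n).differentiableOn one_ne_zero).differentiableAt
              (hsq.mem_nhds (F r hr).2.1))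
            (hmp n)
            (fun r hr => by
              have h := (((hasDerivAt_id r).sub_const t₀).const_mul
                (a (pc t₀) t₀ - η)).const_sub (pc t₀ + ε)
              simpa using h.hasDerivWithinAt)
            (fun r hr => hm n hn r (hIcc hr) _ (F r hr).1.1 (F r hr).1.2)
            (fun r hr => by
              have h := (abs_le.1 (F r hr).2.2).1
              linarith)
        have h1 := hM (Set.left_mem_Icc.2 hlt.le) (Set.right_mem_Icc.2 hlt.le) hlt.le
        simpa using h1
      have hpos : 0 < ⨅ n, Θ n (pc t₀ + ε) t₀ := (hthr t₀ ht₀ (pc t₀ + ε)).2 (by linarith)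
      have hpos' : 0 < ⨅ n, Θ n (pc t₀ + ε - (a (pc t₀) t₀ - η) * (s - t₀)) s :=
        lt_of_lt_of_le hpos (infle _ _ _ _ key)
      have hge : pc s ≤ pc t₀ + ε - (a (pc t₀) t₀ - η) * (s - t₀) := by
        by_contra hcon
        push Not at hcon
        have h0 := (hthr s hs _).1 hcon
        linarith
      have e3 : (a (pc t₀) t₀ - η) * (s - t₀) = a (pc t₀) t₀ * (s - t₀) - η * (s - t₀) := by ring
      rw [abs_of_pos (show 0 < s - t₀ by linarith)]
      linarith
    · subst heq
      simp
      exact hε.le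
    · -- backward segment of slope -(a₀ + η), ending at (pc t₀ + ε, t₀)
      have hcB : |a (pc t₀) t₀ + η| ≤ B := by
        calc |a (pc t₀) t₀ + η| ≤ |a (pc t₀) t₀| + |η| := abs_add_le _ _
          _ ≤ B := by rw [abs_of_pos hη]; linarith
      have hIcc : Set.Icc s t₀ ⊆ Set.Icc lo hi := Set.Icc_subset_Icc hs.1 ht₀.2
      have hrt : ∀ r ∈ Set.Icc s t₀, |r - t₀| ≤ τ := by
        intro r hr
        rw [abs_of_nonpos (by linarith [hr.2])]
        have : |s - t₀| = -(s - t₀) := abs_of_neg (by linarith)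
        linarith [hr.1]
      have F := fun r (hr : r ∈ Set.Icc s t₀) =>
        seg ε (a (pc t₀) t₀ + η) hε hεθ hcB r (hIcc hr) (hrt r hr)
      have key : ∀ n ≥ m, Θ n (pc t₀ + ε) t₀
          ≤ Θ n (pc t₀ + ε - (a (pc t₀) t₀ + η) * (s - t₀)) s := by
        intro n hn
        have hM : AntitoneOn (fun r => Θ n (pc t₀ + ε - (a (pc t₀) t₀ + η) * (r - t₀)) r)
            (Set.Icc s t₀) :=
          fence_antitoneOn (Θ n) a (fun r => pc t₀ + ε - (a (pc t₀) t₀ + η) * (r - t₀))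
            (fun _ => -(a (pc t₀) t₀ + η)) (η / 2) s t₀
            (fun r hr => ((hC1 n).differentiableOn one_ne_zero).differentiableAt
              (hsq.mem_nhds (F r hr).2.1))
            (hmp n)
            (fun r hr => by
              have h := (((hasDerivAt_id r).sub_const t₀).const_mul
                (a (pc t₀) t₀ + η)).const_sub (pc t₀ + ε)
              simpa using h.hasDerivWithinAt)
            (fun r hr => hm n hn r (hIcc hr) _ (F r hr).1.1 (F r hr).1.2)
            (fun r hr => by
              have h := (abs_le.1 (F r hr).2.2).2
              linarith)
        have h1 := hM (Set.left_mem_Icc.2 hgt.le) (Set.right_mem_Icc.2 hgt.le) hgt.le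
        simpa using h1
      have hpos : 0 < ⨅ n, Θ n (pc t₀ + ε) t₀ := (hthr t₀ ht₀ (pc t₀ + ε)).2 (by linarith)
      have hpos' : 0 < ⨅ n, Θ n (pc t₀ + ε - (a (pc t₀) t₀ + η) * (s - t₀)) s :=
        lt_of_lt_of_le hpos (infle _ _ _ _ key)
      have hge : pc s ≤ pc t₀ + ε - (a (pc t₀) t₀ + η) * (s - t₀) := by
        by_contra hcon
        push Not at hcon
        have h0 := (hthr s hs _).1 hcon
        linarith
      have e3 : (a (pc t₀) t₀ + η) * (s - t₀) = a (pc t₀) t₀ * (s - t₀) + η * (s - t₀) := by ring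
      rw [abs_of_neg (show s - t₀ < 0 by linarith)]
      have e4 : η * -(s - t₀) = -(η * (s - t₀)) := by ring
      linarith
  -- ε ↓ 0
  apply le_of_forall_pos_le_add
  intro ε hε
  have h := claim (min ε (θ / 4)) (lt_min hε (by positivity))
    (lt_of_le_of_lt (min_le_right _ _) (by linarith))
  linarith [min_le_left ε (θ / 4)]

/-- Lower fence (zero propagation). -/
theorem stub_lowerFence :
    ∀ (Θ : ℕ → ℝ → ℝ → ℝ) (pc : ℝ → ℝ) (a : ℝ → ℝ → ℝ) (lo hi ρ A : ℝ),
      0 < lo → lo < hi → hi < 1 → 0 < ρ →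
      (∀ n, ContDiffOn ℝ 1 (fun x : ℝ × ℝ => Θ n x.1 x.2) (Set.Ioo 0 1 ×ˢ Set.Ioo 0 1)) →
      (∀ n t, Monotone (fun p => Θ n p t)) →
      (∀ p t, Antitone (fun n => Θ n p t)) →
      (∀ n p t, 0 ≤ Θ n p t) →
      (∀ t ∈ Set.Icc lo hi, ρ < pc t ∧ pc t + ρ < 1) →
      (∀ t ∈ Set.Icc lo hi, ∀ p : ℝ,
          (p < pc t → (⨅ n, Θ n p t) = 0) ∧ (pc t < p → 0 < ⨅ n, Θ n p t)) →
      (∀ t ∈ Set.Icc lo hi, ∀ p : ℝ, |p - pc t| ≤ ρ → |a p t| ≤ A) →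
      (∀ η > (0 : ℝ), ∃ ω > (0 : ℝ), ∀ t ∈ Set.Icc lo hi, ∀ t' ∈ Set.Icc lo hi, ∀ p p' : ℝ,
          |p - pc t| ≤ ρ → |p' - pc t'| ≤ ρ → |t - t'| ≤ ω → |p - p'| ≤ ω →
          |a p t - a p' t'| ≤ η) →
      (∀ κ > (0 : ℝ), ∃ τ > (0 : ℝ), ∀ t ∈ Set.Icc lo hi, ∀ t' ∈ Set.Icc lo hi,
          |t - t'| ≤ τ → |pc t - pc t'| ≤ κ) →
      (∀ η > (0 : ℝ), ∃ δ > (0 : ℝ), ∃ m : ℕ, ∀ n ≥ m, ∀ t ∈ Set.Icc lo hi, ∀ p : ℝ,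
          pc t - δ ≤ p → p ≤ pc t + ρ →
          |deriv (fun s => Θ n p s) t - a p t * deriv (fun q => Θ n q t) p|
            ≤ η * deriv (fun q => Θ n q t) p) →
      ∀ η > (0 : ℝ), ∃ τ > (0 : ℝ), ∀ t₀ ∈ Set.Icc lo hi, ∀ s ∈ Set.Icc lo hi, |s - t₀| ≤ τ →
        -(η * |s - t₀|) ≤ pc s - pc t₀ + a (pc t₀) t₀ * (s - t₀) := by
  intro Θ pc a lo hi ρ A hlo hlohi hhi hρ hC1 hmp hanti hnn hcollar hthr hA hω hτ hex η hη
  -- constants of the construction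
  have hη2 : (0:ℝ) < η / 2 := by positivity
  obtain ⟨δ, hδ, m, hm⟩ := hex (η / 2) hη2
  obtain ⟨ω, hω0, hωa⟩ := hω (η / 2) hη2
  have hκ : 0 < min δ ρ := lt_min hδ hρ
  obtain ⟨τ₁, hτ₁, hpc1⟩ := hτ (min δ ρ / 4) (by positivity)
  have hA0 : 0 ≤ A :=
    le_trans (abs_nonneg _) (hA lo ⟨le_rfl, hlohi.le⟩ (pc lo) (by simp [hρ.le]))
  obtain ⟨θ, hθ0, hθω, hθκ⟩ : ∃ θ : ℝ, 0 < θ ∧ θ ≤ ω ∧ θ ≤ min δ ρ / 4 :=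
    ⟨min ω (min δ ρ / 4), lt_min hω0 (by positivity), min_le_left _ _, min_le_right _ _⟩
  obtain ⟨B, hB0, hBA⟩ : ∃ B : ℝ, 0 < B ∧ A + η ≤ B := ⟨A + η + 1, by positivity, by linarith⟩
  obtain ⟨τ, hτ0, hττ₁, hτω, hτB⟩ : ∃ τ : ℝ, 0 < τ ∧ τ ≤ τ₁ ∧ τ ≤ ω ∧ B * τ ≤ θ / 2 := by
    refine ⟨min τ₁ (min ω (θ / (2 * B))), lt_min hτ₁ (lt_min hω0 (by positivity)),
      min_le_left _ _, le_trans (min_le_right _ _) (min_le_left _ _), ?_⟩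
    have h1 : min τ₁ (min ω (θ / (2 * B))) ≤ θ / (2 * B) :=
      le_trans (min_le_right _ _) (min_le_right _ _)
    calc B * min τ₁ (min ω (θ / (2 * B))) ≤ B * (θ / (2 * B)) :=
          mul_le_mul_of_nonneg_left h1 hB0.le
      _ = θ / 2 := by field_simp
  refine ⟨τ, hτ0, ?_⟩
  intro t₀ ht₀ s hs hst
  -- generic tools
  have bdd : ∀ q r, BddBelow (Set.range fun n => Θ n q r) := fun q r =>
    ⟨0, by rintro _ ⟨n, rfl⟩; exact hnn n q r⟩
  have infle : ∀ q r q' r', (∀ n ≥ m, Θ n q r ≤ Θ n q' r') →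
      (⨅ n, Θ n q r) ≤ ⨅ n, Θ n q' r' := by
    intro q r q' r' h
    refine le_ciInf fun N => ?_
    calc (⨅ n, Θ n q r) ≤ Θ (max N m) q r := ciInf_le (bdd q r) _
      _ ≤ Θ (max N m) q' r' := h _ (le_max_right _ _)
      _ ≤ Θ N q' r' := hanti q' r' (le_max_left _ _)
  have hsq : IsOpen (Set.Ioo (0:ℝ) 1 ×ˢ Set.Ioo (0:ℝ) 1) := isOpen_Ioo.prod isOpen_Ioo
  have ha₀ : |a (pc t₀) t₀| ≤ A := hA t₀ ht₀ (pc t₀) (by simp [hρ.le])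
  have hδρ1 : min δ ρ ≤ δ := min_le_left _ _
  have hδρ2 : min δ ρ ≤ ρ := min_le_right _ _
  -- facts along a straight segment r ↦ pc t₀ - ε - c (r - t₀), ε < θ/2, |c| ≤ B
  have seg : ∀ (ε c : ℝ), 0 < ε → ε < θ / 2 → |c| ≤ B →
      ∀ r ∈ Set.Icc lo hi, |r - t₀| ≤ τ →
        (pc r - δ ≤ pc t₀ - ε - c * (r - t₀) ∧ pc t₀ - ε - c * (r - t₀) ≤ pc r + ρ) ∧
        (pc t₀ - ε - c * (r - t₀) ∈ Set.Ioo (0:ℝ) 1 ∧ r ∈ Set.Ioo (0:ℝ) 1) ∧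
        |a (pc t₀ - ε - c * (r - t₀)) r - a (pc t₀) t₀| ≤ η / 2 := by
    intro ε c hε hεθ hcB r hr hrt
    have h1 : |pc t₀ - ε - c * (r - t₀) - pc t₀| ≤ θ := by
      have e : pc t₀ - ε - c * (r - t₀) - pc t₀ = -(ε + c * (r - t₀)) := by ring
      rw [e, abs_neg]
      have hct : |c| * |r - t₀| ≤ B * τ :=
        mul_le_mul hcB hrt (abs_nonneg _) hB0.le
      calc |ε + c * (r - t₀)| ≤ |ε| + |c * (r - t₀)| := abs_add_le _ _
        _ = ε + |c| * |r - t₀| := by rw [abs_of_pos hε, abs_mul]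
        _ ≤ θ := by linarith
    have h2 : |pc r - pc t₀| ≤ min δ ρ / 4 := hpc1 r hr t₀ ht₀ (hrt.trans hττ₁)
    have h3 : |pc t₀ - ε - c * (r - t₀) - pc r| ≤ min δ ρ / 2 := by
      have e : pc t₀ - ε - c * (r - t₀) - pc r
          = (pc t₀ - ε - c * (r - t₀) - pc t₀) - (pc r - pc t₀) := by ring
      rw [e]
      calc |(pc t₀ - ε - c * (r - t₀) - pc t₀) - (pc r - pc t₀)|
          ≤ |pc t₀ - ε - c * (r - t₀) - pc t₀| + |pc r - pc t₀| := abs_sub _ _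
        _ ≤ θ + min δ ρ / 4 := by linarith
        _ ≤ min δ ρ / 2 := by linarith
    obtain ⟨h3a, h3b⟩ := abs_le.1 h3
    obtain ⟨hc1, hc2⟩ := hcollar r hr
    refine ⟨⟨by linarith, by linarith⟩,
      ⟨⟨by linarith, by linarith⟩, ⟨by linarith [hr.1], by linarith [hr.2]⟩⟩, ?_⟩
    exact hωa r hr t₀ ht₀ (pc t₀ - ε - c * (r - t₀)) (pc t₀)
      (by rw [abs_le]; constructor <;> linarith) (by simp [hρ.le]) (le_trans hrt hτω)
      (le_trans h1 hθω)
  -- the claim at every small ε > 0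
  have claim : ∀ ε : ℝ, 0 < ε → ε < θ / 2 →
      -(η * |s - t₀|) ≤ pc s - pc t₀ + a (pc t₀) t₀ * (s - t₀) + ε := by
    intro ε hε hεθ
    rcases lt_trichotomy t₀ s with hlt | heq | hgt
    · -- forward segment of slope -(a₀ + η), issued from (pc t₀ - ε, t₀): zero propagates forward
      have hcB : |a (pc t₀) t₀ + η| ≤ B := by
        calc |a (pc t₀) t₀ + η| ≤ |a (pc t₀) t₀| + |η| := abs_add_le _ _
          _ ≤ B := by rw [abs_of_pos hη]; linarith
      have hIcc : Set.Icc t₀ s ⊆ Set.Icc lo hi := Set.Icc_subset_Icc ht₀.1 hs.2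
      have hrt : ∀ r ∈ Set.Icc t₀ s, |r - t₀| ≤ τ := by
        intro r hr
        rw [abs_of_nonneg (by linarith [hr.1])]
        have : |s - t₀| = s - t₀ := abs_of_pos (by linarith)
        linarith [hr.2]
      have F := fun r (hr : r ∈ Set.Icc t₀ s) =>
        seg ε (a (pc t₀) t₀ + η) hε hεθ hcB r (hIcc hr) (hrt r hr)
      have key : ∀ n ≥ m, Θ n (pc t₀ - ε - (a (pc t₀) t₀ + η) * (s - t₀)) s
          ≤ Θ n (pc t₀ - ε) t₀ := by
        intro n hn
        have hM : AntitoneOn (fun r => Θ n (pc t₀ - ε - (a (pc t₀) t₀ + η) * (r - t₀)) r)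
            (Set.Icc t₀ s) :=
          fence_antitoneOn (Θ n) a (fun r => pc t₀ - ε - (a (pc t₀) t₀ + η) * (r - t₀))
            (fun _ => -(a (pc t₀) t₀ + η)) (η / 2) t₀ s
            (fun r hr => ((hC1 n).differentiableOn one_ne_zero).differentiableAt
              (hsq.mem_nhds (F r hr).2.1))
            (hmp n)
            (fun r hr => by
              have h := (((hasDerivAt_id r).sub_const t₀).const_mul
                (a (pc t₀) t₀ + η)).const_sub (pc t₀ - ε)
              simpa using h.hasDerivWithinAt)
            (fun r hr => hm n hn r (hIcc hr) _ (F r hr).1.1 (F r hr).1.2)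
            (fun r hr => by
              have h := (abs_le.1 (F r hr).2.2).2
              linarith)
        have h1 := hM (Set.left_mem_Icc.2 hlt.le) (Set.right_mem_Icc.2 hlt.le) hlt.le
        simpa using h1
      have hzero : (⨅ n, Θ n (pc t₀ - ε) t₀) = 0 := (hthr t₀ ht₀ (pc t₀ - ε)).1 (by linarith)
      have hle0 : (⨅ n, Θ n (pc t₀ - ε - (a (pc t₀) t₀ + η) * (s - t₀)) s) ≤ 0 := by
        have := infle _ _ _ _ key
        rwa [hzero] at this
      have hge : pc t₀ - ε - (a (pc t₀) t₀ + η) * (s - t₀) ≤ pc s := by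
        by_contra hcon
        push Not at hcon
        have h0 := (hthr s hs _).2 hcon
        linarith
      have e3 : (a (pc t₀) t₀ + η) * (s - t₀) = a (pc t₀) t₀ * (s - t₀) + η * (s - t₀) := by ring
      rw [abs_of_pos (show 0 < s - t₀ by linarith)]
      linarith
    · subst heq
      simp
      exact hε.le
    · -- backward segment of slope -(a₀ - η), ending at (pc t₀ - ε, t₀): zero propagates backward
      have hcB : |a (pc t₀) t₀ - η| ≤ B := by
        calc |a (pc t₀) t₀ - η| ≤ |a (pc t₀) t₀| + |η| := abs_sub _ _
          _ ≤ B := by rw [abs_of_pos hη]; linarith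
      have hIcc : Set.Icc s t₀ ⊆ Set.Icc lo hi := Set.Icc_subset_Icc hs.1 ht₀.2
      have hrt : ∀ r ∈ Set.Icc s t₀, |r - t₀| ≤ τ := by
        intro r hr
        rw [abs_of_nonpos (by linarith [hr.2])]
        have : |s - t₀| = -(s - t₀) := abs_of_neg (by linarith)
        linarith [hr.1]
      have F := fun r (hr : r ∈ Set.Icc s t₀) =>
        seg ε (a (pc t₀) t₀ - η) hε hεθ hcB r (hIcc hr) (hrt r hr)
      have key : ∀ n ≥ m, Θ n (pc t₀ - ε - (a (pc t₀) t₀ - η) * (s - t₀)) s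
          ≤ Θ n (pc t₀ - ε) t₀ := by
        intro n hn
        have hM : MonotoneOn (fun r => Θ n (pc t₀ - ε - (a (pc t₀) t₀ - η) * (r - t₀)) r)
            (Set.Icc s t₀) :=
          fence_monotoneOn (Θ n) a (fun r => pc t₀ - ε - (a (pc t₀) t₀ - η) * (r - t₀))
            (fun _ => -(a (pc t₀) t₀ - η)) (η / 2) s t₀
            (fun r hr => ((hC1 n).differentiableOn one_ne_zero).differentiableAt
              (hsq.mem_nhds (F r hr).2.1))
            (hmp n)
            (fun r hr => by
              have h := (((hasDerivAt_id r).sub_const t₀).const_mul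
                (a (pc t₀) t₀ - η)).const_sub (pc t₀ - ε)
              simpa using h.hasDerivWithinAt)
            (fun r hr => hm n hn r (hIcc hr) _ (F r hr).1.1 (F r hr).1.2)
            (fun r hr => by
              have h := (abs_le.1 (F r hr).2.2).1
              linarith)
        have h1 := hM (Set.left_mem_Icc.2 hgt.le) (Set.right_mem_Icc.2 hgt.le) hgt.le
        simpa using h1
      have hzero : (⨅ n, Θ n (pc t₀ - ε) t₀) = 0 := (hthr t₀ ht₀ (pc t₀ - ε)).1 (by linarith)
      have hle0 : (⨅ n, Θ n (pc t₀ - ε - (a (pc t₀) t₀ - η) * (s - t₀)) s) ≤ 0 := by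
        have := infle _ _ _ _ key
        rwa [hzero] at this
      have hge : pc t₀ - ε - (a (pc t₀) t₀ - η) * (s - t₀) ≤ pc s := by
        by_contra hcon
        push Not at hcon
        have h0 := (hthr s hs _).2 hcon
        linarith
      have e3 : (a (pc t₀) t₀ - η) * (s - t₀) = a (pc t₀) t₀ * (s - t₀) - η * (s - t₀) := by ring
      rw [abs_of_neg (show s - t₀ < 0 by linarith)]
      have e4 : η * -(s - t₀) = -(η * (s - t₀)) := by ring
      linarith
  -- ε ↓ 0
  apply le_of_forall_pos_le_add
  intro ε hε
  have h := claim (min ε (θ / 4)) (lt_min hε (by positivity))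
    (lt_of_le_of_lt (min_le_right _ _) (by linarith))
  linarith [min_le_left ε (θ / 4)]


/-! ## §3  Glue (proved): cone ⇒ derivative, Heine–Cantor moduli -/

/-- Uniform two-sided cone bounds give the derivative within the set. -/
theorem hasDerivWithinAt_of_cone (pc : ℝ → ℝ) (S : Set ℝ) (t₀ c : ℝ)
    (h : ∀ η > (0:ℝ), ∃ τ > (0:ℝ), ∀ s ∈ S, |s - t₀| ≤ τ →
      |pc s - pc t₀ - c * (s - t₀)| ≤ η * |s - t₀|) :
    HasDerivWithinAt pc c S t₀ := by
  rw [hasDerivWithinAt_iff_isLittleO, Asymptotics.isLittleO_iff]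
  intro η hη
  obtain ⟨τ, hτ, hb⟩ := h η hη
  rw [eventually_nhdsWithin_iff, Metric.eventually_nhds_iff]
  refine ⟨τ, hτ, fun s hs hsS => ?_⟩
  have h1 := hb s hsS (by rw [Real.dist_eq] at hs; exact hs.le)
  simp only [Real.norm_eq_abs, smul_eq_mul]
  rwa [mul_comm (s - t₀) c]

/-- Uniform continuity of `pc` on `[lo,hi]`, in `ε–δ` form. -/
theorem pc_modulus (pc : ℝ → ℝ) (lo hi : ℝ) (hpc : ContinuousOn pc (Icc lo hi)) :
    ∀ κ > (0:ℝ), ∃ τ > (0:ℝ), ∀ t ∈ Icc lo hi, ∀ t' ∈ Icc lo hi, |t - t'| ≤ τ →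
      |pc t - pc t'| ≤ κ := by
  have hu : UniformContinuousOn pc (Icc lo hi) :=
    isCompact_Icc.uniformContinuousOn_of_continuous hpc
  rw [Metric.uniformContinuousOn_iff_le] at hu
  intro κ hκ
  obtain ⟨τ, hτ, h⟩ := hu κ hκ
  refine ⟨τ, hτ, fun t ht t' ht' htt' => ?_⟩
  have := h t ht t' ht' (by rw [Real.dist_eq]; exact htt')
  rwa [Real.dist_eq] at this

/-- Heine–Cantor on the two-sided closed collar (a continuous image of a compact rectangle):
a bound and a uniform modulus for `a`. -/
theorem collar_moduli (pc : ℝ → ℝ) (a : ℝ → ℝ → ℝ) (lo hi ρ : ℝ)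
    (hpc : ContinuousOn pc (Icc lo hi))
    (ha : ContinuousOn (fun x : ℝ × ℝ => a x.1 x.2)
      {x : ℝ × ℝ | x.2 ∈ Icc lo hi ∧ |x.1 - pc x.2| ≤ ρ}) :
    (∃ A : ℝ, ∀ t ∈ Icc lo hi, ∀ p : ℝ, |p - pc t| ≤ ρ → |a p t| ≤ A) ∧
    (∀ η > (0:ℝ), ∃ ω > (0:ℝ), ∀ t ∈ Icc lo hi, ∀ t' ∈ Icc lo hi, ∀ p p' : ℝ,
      |p - pc t| ≤ ρ → |p' - pc t'| ≤ ρ → |t - t'| ≤ ω → |p - p'| ≤ ω →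
      |a p t - a p' t'| ≤ η) := by
  set C : Set (ℝ × ℝ) := {x : ℝ × ℝ | x.2 ∈ Icc lo hi ∧ |x.1 - pc x.2| ≤ ρ} with hC
  set K : Set (ℝ × ℝ) := Icc lo hi ×ˢ Icc (-ρ) ρ with hK
  set φ : ℝ × ℝ → ℝ × ℝ := fun y => (pc y.1 + y.2, y.1) with hφ
  have hKc : IsCompact K := isCompact_Icc.prod isCompact_Icc
  have hφc : ContinuousOn φ K := by
    have h1 : ContinuousOn (fun y : ℝ × ℝ => pc y.1) K :=
      hpc.comp continuous_fst.continuousOn (fun y hy => hy.1)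
    exact ((h1.add continuous_snd.continuousOn).prodMk continuous_fst.continuousOn)
  have hCK : C = φ '' K := by
    ext x
    constructor
    · rintro ⟨hx2, hx1⟩
      refine ⟨(x.2, x.1 - pc x.2), ⟨hx2, ?_⟩, ?_⟩
      · exact abs_le.1 hx1
      · simp only [hφ]; ext <;> simp
    · rintro ⟨y, ⟨hy1, hy2⟩, rfl⟩
      refine ⟨hy1, ?_⟩
      show |pc y.1 + y.2 - pc y.1| ≤ ρ
      rw [add_sub_cancel_left]
      exact abs_le.2 hy2
  have hCc : IsCompact C := by rw [hCK]; exact hKc.image_of_continuousOn hφc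
  constructor
  · obtain ⟨A, hA⟩ := hCc.exists_bound_of_continuousOn ha
    refine ⟨A, fun t ht p hp => ?_⟩
    have := hA (p, t) ⟨ht, hp⟩
    simpa [Real.norm_eq_abs] using this
  · intro η hη
    have hu := hCc.uniformContinuousOn_of_continuous ha
    rw [Metric.uniformContinuousOn_iff_le] at hu
    obtain ⟨ω, hω, h⟩ := hu η hη
    refine ⟨ω, hω, fun t ht t' ht' p p' hp hp' htt hpp => ?_⟩
    have hd : dist ((p, t) : ℝ × ℝ) (p', t') ≤ ω := by
      rw [Prod.dist_eq, Real.dist_eq, Real.dist_eq]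
      exact max_le hpp htt
    have := h (p, t) ⟨ht, hp⟩ (p', t') ⟨ht', hp'⟩ hd
    rwa [Real.dist_eq] at this

/-! ## §4  Level transport with the exact corrector (proved; = `birth.stub_levelTransport`) -/

/-- **Level transport (proved).** Given the characteristic property of `pc` and the right-collar
hypotheses, for `lo ≤ t₀ ≤ t₁ ≤ hi` and every `ε ∈ (0, ρ)`:
`Θ∞ (pc t₁) t₁ ≤ Θ∞ (pc t₀ + ε) t₀` and `Θ∞ (pc t₀) t₀ ≤ Θ∞ (pc t₁ + ε) t₁`.
Engine: `γ = pc + g` with `g(s) = (ε + η/L')e^{−L'(s−t₀)} − η/L'` (decreasing corrector) resp.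
`g(s) = (η/L')(e^{L'(s−t₀)} − 1)` (increasing corrector), `η = L' ε e^{−L'(t₁−t₀)}/2`,
`L' = max L 1`; the fence lemma does the rest. -/
theorem levelTransport :
    ∀ (Θ : ℕ → ℝ → ℝ → ℝ) (pc : ℝ → ℝ) (a : ℝ → ℝ → ℝ) (lo hi ρ L : ℝ),
      0 < lo → lo < hi → hi < 1 → 0 < ρ →
      (∀ n, ContDiffOn ℝ 1 (fun x : ℝ × ℝ => Θ n x.1 x.2) (Set.Ioo 0 1 ×ˢ Set.Ioo 0 1)) →
      (∀ n t, Monotone (fun p => Θ n p t)) →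
      (∀ p t, Antitone (fun n => Θ n p t)) →
      (∀ n p t, 0 ≤ Θ n p t) →
      ContinuousOn pc (Set.Icc lo hi) →
      (∀ t ∈ Set.Icc lo hi, ρ < pc t ∧ pc t + ρ < 1) →
      ContinuousOn (fun x : ℝ × ℝ => a x.1 x.2)
          {x : ℝ × ℝ | x.2 ∈ Set.Icc lo hi ∧ pc x.2 ≤ x.1 ∧ x.1 ≤ pc x.2 + ρ} →
      (∀ t ∈ Set.Icc lo hi, ∀ p q : ℝ, pc t ≤ p → p ≤ pc t + ρ → pc t ≤ q → q ≤ pc t + ρ →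
          |a p t - a q t| ≤ L * |p - q|) →
      (∀ η > (0 : ℝ), ∃ m : ℕ, ∀ n ≥ m, ∀ t ∈ Set.Icc lo hi, ∀ p : ℝ,
          pc t ≤ p → p ≤ pc t + ρ →
          |deriv (fun s => Θ n p s) t - a p t * deriv (fun q => Θ n q t) p|
            ≤ η * deriv (fun q => Θ n q t) p) →
      (∀ t ∈ Set.Icc lo hi, HasDerivWithinAt pc (-(a (pc t) t)) (Set.Icc lo hi) t) →
      ∀ t₀ t₁ : ℝ, lo ≤ t₀ → t₀ ≤ t₁ → t₁ ≤ hi →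
        ∃ ε₀ > (0 : ℝ), ∀ ε : ℝ, 0 < ε → ε < ε₀ →
          (⨅ n, Θ n (pc t₁) t₁) ≤ (⨅ n, Θ n (pc t₀ + ε) t₀) ∧
          (⨅ n, Θ n (pc t₀) t₀) ≤ (⨅ n, Θ n (pc t₁ + ε) t₁) := by
  intro Θ pc a lo hi ρ L hlo hlohi hhi hρ hC1 hmp hanti hnn hpc hcollar ha hL hex hchar
    t₀ t₁ ht₀ ht₀₁ ht₁
  refine ⟨ρ, hρ, fun ε hε hερ => ?_⟩
  -- constants
  obtain ⟨L', hLL', hL'pos⟩ : ∃ L' : ℝ, L ≤ L' ∧ 0 < L' :=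
    ⟨max L 1, le_max_left _ _, lt_of_lt_of_le one_pos (le_max_right _ _)⟩
  set T : ℝ := t₁ - t₀ with hT
  have hT0 : 0 ≤ T := by rw [hT]; linarith
  set E₀ : ℝ := Real.exp (-(L' * T)) with hE₀
  have hE₀pos : 0 < E₀ := Real.exp_pos _
  have hE₀le : E₀ ≤ 1 := by
    rw [hE₀]; apply Real.exp_le_one_iff.mpr; nlinarith
  set η : ℝ := L' * ε * E₀ / 2 with hη
  have hηpos : 0 < η := by positivity
  have hηL' : η / L' = ε * E₀ / 2 := by
    rw [hη]; field_simp
  obtain ⟨m, hm⟩ := hex η hηpos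
  -- bookkeeping
  have hIcc : Set.Icc t₀ t₁ ⊆ Set.Icc lo hi := Set.Icc_subset_Icc ht₀ ht₁
  have bdd : ∀ q s, BddBelow (Set.range fun n => Θ n q s) := fun q s =>
    ⟨0, by rintro _ ⟨n, rfl⟩; exact hnn n q s⟩
  have infle : ∀ q s q' s', (∀ n ≥ m, Θ n q s ≤ Θ n q' s') →
      (⨅ n, Θ n q s) ≤ ⨅ n, Θ n q' s' := by
    intro q s q' s' h
    refine le_ciInf fun N => ?_
    calc (⨅ n, Θ n q s) ≤ Θ (max N m) q s := ciInf_le (bdd q s) _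
      _ ≤ Θ (max N m) q' s' := h _ (le_max_right _ _)
      _ ≤ Θ N q' s' := hanti q' s' (le_max_left _ _)
  have hsq : IsOpen (Set.Ioo (0:ℝ) 1 ×ˢ Set.Ioo (0:ℝ) 1) := isOpen_Ioo.prod isOpen_Ioo
  have hdiff : ∀ n, ∀ s ∈ Set.Icc t₀ t₁, ∀ q, pc s ≤ q → q < pc s + ρ →
      DifferentiableAt ℝ (fun x : ℝ × ℝ => Θ n x.1 x.2) (q, s) := by
    intro n s hs q hq1 hq2
    have hs' := hIcc hs
    obtain ⟨hc1, hc2⟩ := hcollar s hs'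
    apply ((hC1 n).differentiableOn one_ne_zero).differentiableAt
    apply hsq.mem_nhds
    refine ⟨⟨by linarith, by linarith⟩, ⟨by linarith [hs'.1], by linarith [hs'.2]⟩⟩
  -- exponential bounds on [t₀,t₁]
  have hexp_le_one : ∀ s ∈ Set.Icc t₀ t₁, Real.exp (-(L' * (s - t₀))) ≤ 1 := by
    intro s hs
    apply Real.exp_le_one_iff.mpr
    nlinarith [hs.1]
  have hexp_ge : ∀ s ∈ Set.Icc t₀ t₁, E₀ ≤ Real.exp (-(L' * (s - t₀))) := by
    intro s hs
    rw [hE₀]; apply Real.exp_le_exp.mpr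
    nlinarith [hs.2]
  have hexp_ge' : ∀ s ∈ Set.Icc t₀ t₁, 1 ≤ Real.exp (L' * (s - t₀)) := by
    intro s hs
    apply Real.one_le_exp_iff.mpr
    nlinarith [hs.1]
  have hexp_le' : ∀ s ∈ Set.Icc t₀ t₁, Real.exp (L' * (s - t₀)) ≤ 1 / E₀ := by
    intro s hs
    rw [hE₀, one_div, ← Real.exp_neg, neg_neg]
    apply Real.exp_le_exp.mpr
    nlinarith [hs.2]
  constructor
  · ----------------------------------------------------------------
    -- (i) decreasing corrector g s = (ε + η/L') e^{-L'(s-t₀)} - η/L'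
    ----------------------------------------------------------------
    set g : ℝ → ℝ := fun s => (ε + η / L') * Real.exp (-(L' * (s - t₀))) - η / L' with hg
    set g' : ℝ → ℝ := fun s => -(L' * g s) - η with hg'
    have hgd : ∀ s, HasDerivAt g (g' s) s := by
      intro s
      have h1 : HasDerivAt (fun r => -(L' * (r - t₀))) (-(L' * 1)) s :=
        (((hasDerivAt_id s).sub_const t₀).const_mul L').neg
      have h2 := ((h1.exp).const_mul (ε + η / L')).sub_const (η / L')
      refine h2.congr_deriv ?_
      have hLη : L' * (η / L') = η := by field_simp
      simp only [hg', hg]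
      generalize Real.exp (-(L' * (s - t₀))) = E
      rw [mul_sub, hLη]
      ring
    have hg0 : g t₀ = ε := by
      simp only [hg, sub_self, mul_zero, neg_zero, Real.exp_zero, mul_one]; ring
    have hg_le : ∀ s ∈ Set.Icc t₀ t₁, g s ≤ ε := by
      intro s hs
      have h1 := hexp_le_one s hs
      have hpos : 0 ≤ ε + η / L' := by positivity
      have : (ε + η / L') * Real.exp (-(L' * (s - t₀))) ≤ (ε + η / L') * 1 :=
        mul_le_mul_of_nonneg_left h1 hpos
      simp only [hg]; linarith
    have hg_pos : ∀ s ∈ Set.Icc t₀ t₁, 0 < g s := by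
      intro s hs
      have h1 := hexp_ge s hs
      have hpos : 0 ≤ ε + η / L' := by positivity
      have h2 : (ε + η / L') * E₀ ≤ (ε + η / L') * Real.exp (-(L' * (s - t₀))) :=
        mul_le_mul_of_nonneg_left h1 hpos
      have h3 : 0 < (ε + η / L') * E₀ - η / L' := by
        rw [hηL']; nlinarith [mul_pos hε hE₀pos, sq_nonneg E₀]
      simp only [hg]; linarith
    -- the curve γ = pc + g
    set γ : ℝ → ℝ := fun s => pc s + g s with hγ
    have hγ_ge : ∀ s ∈ Set.Icc t₀ t₁, pc s ≤ γ s := fun s hs => by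
      simp only [hγ]; linarith [hg_pos s hs]
    have hγ_lt : ∀ s ∈ Set.Icc t₀ t₁, γ s < pc s + ρ := fun s hs => by
      simp only [hγ]; linarith [hg_le s hs]
    have hγd : ∀ s ∈ Set.Icc t₀ t₁,
        HasDerivWithinAt γ (-(a (pc s) s) + g' s) (Set.Icc t₀ t₁) s := fun s hs =>
      ((hchar s (hIcc hs)).mono hIcc).add (hgd s).hasDerivWithinAt
    have hslope : ∀ s ∈ Set.Icc t₀ t₁, (-(a (pc s) s) + g' s) + a (γ s) s ≤ -η := by
      intro s hs
      have hs' := hIcc hs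
      have h1 := hL s hs' (γ s) (pc s) (hγ_ge s hs) (hγ_lt s hs).le le_rfl (by linarith)
      have e1 : |γ s - pc s| = g s := by
        rw [abs_of_nonneg (by simp only [hγ]; linarith [hg_pos s hs])]; simp only [hγ]; ring
      rw [e1] at h1
      have h2 : a (γ s) s - a (pc s) s ≤ L' * g s := by
        have := (abs_le.1 h1).2
        nlinarith [hg_pos s hs]
      simp only [hg'] at *
      linarith
    have key : ∀ n ≥ m, Θ n (pc t₁) t₁ ≤ Θ n (pc t₀ + ε) t₀ := by
      intro n hn
      have hA : AntitoneOn (fun s => Θ n (γ s) s) (Set.Icc t₀ t₁) :=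
        fence_antitoneOn (Θ n) a γ (fun s => -(a (pc s) s) + g' s) η t₀ t₁
          (fun s hs => hdiff n s hs (γ s) (hγ_ge s hs) (hγ_lt s hs))
          (hmp n) hγd
          (fun s hs => hm n hn s (hIcc hs) (γ s) (hγ_ge s hs) (hγ_lt s hs).le)
          hslope
      have h1 : Θ n (γ t₁) t₁ ≤ Θ n (γ t₀) t₀ :=
        hA (Set.left_mem_Icc.2 ht₀₁) (Set.right_mem_Icc.2 ht₀₁) ht₀₁
      have h2 : γ t₀ = pc t₀ + ε := by simp only [hγ, hg0]
      have h3 : Θ n (pc t₁) t₁ ≤ Θ n (γ t₁) t₁ := hmp n t₁ (hγ_ge t₁ (Set.right_mem_Icc.2 ht₀₁))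
      rw [h2] at h1
      exact h3.trans h1
    exact infle _ _ _ _ key
  · ----------------------------------------------------------------
    -- (ii) increasing corrector g s = (η/L') (e^{L'(s-t₀)} - 1)
    ----------------------------------------------------------------
    set g : ℝ → ℝ := fun s => (η / L') * (Real.exp (L' * (s - t₀)) - 1) with hg
    set g' : ℝ → ℝ := fun s => L' * g s + η with hg'
    have hgd : ∀ s, HasDerivAt g (g' s) s := by
      intro s
      have h1 : HasDerivAt (fun r => L' * (r - t₀)) (L' * 1) s :=
        ((hasDerivAt_id s).sub_const t₀).const_mul L'
      have h2 := ((h1.exp).sub_const 1).const_mul (η / L')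
      refine h2.congr_deriv ?_
      have hLη : η / L' * L' = η := by field_simp
      simp only [hg', hg]
      generalize Real.exp (L' * (s - t₀)) = E
      calc η / L' * (E * (L' * 1)) = (η / L' * L') * E := by ring
        _ = η * E := by rw [hLη]
        _ = (η / L' * L') * (E - 1) + η := by rw [hLη]; ring
        _ = L' * (η / L' * (E - 1)) + η := by ring
    have hg0 : g t₀ = 0 := by
      simp only [hg, sub_self, mul_zero, Real.exp_zero, sub_self, mul_zero]
    have hg_nn : ∀ s ∈ Set.Icc t₀ t₁, 0 ≤ g s := by
      intro s hs
      have h1 := hexp_ge' s hs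
      have : 0 ≤ η / L' := by positivity
      simp only [hg]
      exact mul_nonneg this (by linarith)
    have hg_lt : ∀ s ∈ Set.Icc t₀ t₁, g s < ε := by
      intro s hs
      have h1 := hexp_le' s hs
      have h0 : 0 ≤ η / L' := by positivity
      have h2 : g s ≤ (η / L') * (1 / E₀ - 1) := by
        simp only [hg]; exact mul_le_mul_of_nonneg_left (by linarith) h0
      have h3 : (η / L') * (1 / E₀ - 1) < ε := by
        rw [hηL']
        field_simp
        nlinarith [mul_pos hε hE₀pos, mul_pos (mul_pos hε hE₀pos) hE₀pos]
      linarith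
    set γ : ℝ → ℝ := fun s => pc s + g s with hγ
    have hγ_ge : ∀ s ∈ Set.Icc t₀ t₁, pc s ≤ γ s := fun s hs => by
      simp only [hγ]; linarith [hg_nn s hs]
    have hγ_lt : ∀ s ∈ Set.Icc t₀ t₁, γ s < pc s + ρ := fun s hs => by
      simp only [hγ]; linarith [hg_lt s hs]
    have hγd : ∀ s ∈ Set.Icc t₀ t₁,
        HasDerivWithinAt γ (-(a (pc s) s) + g' s) (Set.Icc t₀ t₁) s := fun s hs =>
      ((hchar s (hIcc hs)).mono hIcc).add (hgd s).hasDerivWithinAt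
    have hslope : ∀ s ∈ Set.Icc t₀ t₁, η ≤ (-(a (pc s) s) + g' s) + a (γ s) s := by
      intro s hs
      have hs' := hIcc hs
      have h1 := hL s hs' (γ s) (pc s) (hγ_ge s hs) (hγ_lt s hs).le le_rfl (by linarith)
      have e1 : |γ s - pc s| = g s := by
        rw [abs_of_nonneg (by simp only [hγ]; linarith [hg_nn s hs])]; simp only [hγ]; ring
      rw [e1] at h1
      have h2 : -(L' * g s) ≤ a (γ s) s - a (pc s) s := by
        have := (abs_le.1 h1).1
        nlinarith [hg_nn s hs]
      simp only [hg'] at *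
      linarith
    have key : ∀ n ≥ m, Θ n (pc t₀) t₀ ≤ Θ n (pc t₁ + ε) t₁ := by
      intro n hn
      have hM : MonotoneOn (fun s => Θ n (γ s) s) (Set.Icc t₀ t₁) :=
        fence_monotoneOn (Θ n) a γ (fun s => -(a (pc s) s) + g' s) η t₀ t₁
          (fun s hs => hdiff n s hs (γ s) (hγ_ge s hs) (hγ_lt s hs))
          (hmp n) hγd
          (fun s hs => hm n hn s (hIcc hs) (γ s) (hγ_ge s hs) (hγ_lt s hs).le)
          hslope
      have h1 : Θ n (γ t₀) t₀ ≤ Θ n (γ t₁) t₁ :=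
        hM (Set.left_mem_Icc.2 ht₀₁) (Set.right_mem_Icc.2 ht₀₁) ht₀₁
      have h2 : γ t₀ = pc t₀ := by simp only [hγ, hg0, add_zero]
      have h3 : Θ n (γ t₁) t₁ ≤ Θ n (pc t₁ + ε) t₁ :=
        hmp n t₁ (by simp only [hγ]; linarith [hg_lt t₁ (Set.right_mem_Icc.2 ht₀₁)])
      rw [h2] at h1
      exact h1.trans h3
    exact infle _ _ _ _ key

/-! ## §5  Pinching from the two fences (proved) -/

/-- **Fences ⇒ the curve is a characteristic.** The two stub STATEMENTS imply the pinching
statement of line `birth` (its `stub_curveIsCharacteristic`, verbatim): the moduli are supplied by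
`collar_moduli` / `pc_modulus`, and the two one-sided cone bounds give the derivative by
`hasDerivWithinAt_of_cone`. -/
theorem curveIsCharacteristic_of_fences
    (hU : ∀ (Θ : ℕ → ℝ → ℝ → ℝ) (pc : ℝ → ℝ) (a : ℝ → ℝ → ℝ) (lo hi ρ A : ℝ),
      0 < lo → lo < hi → hi < 1 → 0 < ρ →
      (∀ n, ContDiffOn ℝ 1 (fun x : ℝ × ℝ => Θ n x.1 x.2) (Set.Ioo 0 1 ×ˢ Set.Ioo 0 1)) →
      (∀ n t, Monotone (fun p => Θ n p t)) →
      (∀ p t, Antitone (fun n => Θ n p t)) →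
      (∀ n p t, 0 ≤ Θ n p t) →
      (∀ t ∈ Set.Icc lo hi, ρ < pc t ∧ pc t + ρ < 1) →
      (∀ t ∈ Set.Icc lo hi, ∀ p : ℝ,
          (p < pc t → (⨅ n, Θ n p t) = 0) ∧ (pc t < p → 0 < ⨅ n, Θ n p t)) →
      (∀ t ∈ Set.Icc lo hi, ∀ p : ℝ, |p - pc t| ≤ ρ → |a p t| ≤ A) →
      (∀ η > (0 : ℝ), ∃ ω > (0 : ℝ), ∀ t ∈ Set.Icc lo hi, ∀ t' ∈ Set.Icc lo hi, ∀ p p' : ℝ,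
          |p - pc t| ≤ ρ → |p' - pc t'| ≤ ρ → |t - t'| ≤ ω → |p - p'| ≤ ω →
          |a p t - a p' t'| ≤ η) →
      (∀ κ > (0 : ℝ), ∃ τ > (0 : ℝ), ∀ t ∈ Set.Icc lo hi, ∀ t' ∈ Set.Icc lo hi,
          |t - t'| ≤ τ → |pc t - pc t'| ≤ κ) →
      (∀ η > (0 : ℝ), ∃ δ > (0 : ℝ), ∃ m : ℕ, ∀ n ≥ m, ∀ t ∈ Set.Icc lo hi, ∀ p : ℝ,
          pc t - δ ≤ p → p ≤ pc t + ρ →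
          |deriv (fun s => Θ n p s) t - a p t * deriv (fun q => Θ n q t) p|
            ≤ η * deriv (fun q => Θ n q t) p) →
      ∀ η > (0 : ℝ), ∃ τ > (0 : ℝ), ∀ t₀ ∈ Set.Icc lo hi, ∀ s ∈ Set.Icc lo hi, |s - t₀| ≤ τ →
        pc s - pc t₀ + a (pc t₀) t₀ * (s - t₀) ≤ η * |s - t₀|)
    (hLo : ∀ (Θ : ℕ → ℝ → ℝ → ℝ) (pc : ℝ → ℝ) (a : ℝ → ℝ → ℝ) (lo hi ρ A : ℝ),
      0 < lo → lo < hi → hi < 1 → 0 < ρ →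
      (∀ n, ContDiffOn ℝ 1 (fun x : ℝ × ℝ => Θ n x.1 x.2) (Set.Ioo 0 1 ×ˢ Set.Ioo 0 1)) →
      (∀ n t, Monotone (fun p => Θ n p t)) →
      (∀ p t, Antitone (fun n => Θ n p t)) →
      (∀ n p t, 0 ≤ Θ n p t) →
      (∀ t ∈ Set.Icc lo hi, ρ < pc t ∧ pc t + ρ < 1) →
      (∀ t ∈ Set.Icc lo hi, ∀ p : ℝ,
          (p < pc t → (⨅ n, Θ n p t) = 0) ∧ (pc t < p → 0 < ⨅ n, Θ n p t)) →
      (∀ t ∈ Set.Icc lo hi, ∀ p : ℝ, |p - pc t| ≤ ρ → |a p t| ≤ A) →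
      (∀ η > (0 : ℝ), ∃ ω > (0 : ℝ), ∀ t ∈ Set.Icc lo hi, ∀ t' ∈ Set.Icc lo hi, ∀ p p' : ℝ,
          |p - pc t| ≤ ρ → |p' - pc t'| ≤ ρ → |t - t'| ≤ ω → |p - p'| ≤ ω →
          |a p t - a p' t'| ≤ η) →
      (∀ κ > (0 : ℝ), ∃ τ > (0 : ℝ), ∀ t ∈ Set.Icc lo hi, ∀ t' ∈ Set.Icc lo hi,
          |t - t'| ≤ τ → |pc t - pc t'| ≤ κ) →
      (∀ η > (0 : ℝ), ∃ δ > (0 : ℝ), ∃ m : ℕ, ∀ n ≥ m, ∀ t ∈ Set.Icc lo hi, ∀ p : ℝ,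
          pc t - δ ≤ p → p ≤ pc t + ρ →
          |deriv (fun s => Θ n p s) t - a p t * deriv (fun q => Θ n q t) p|
            ≤ η * deriv (fun q => Θ n q t) p) →
      ∀ η > (0 : ℝ), ∃ τ > (0 : ℝ), ∀ t₀ ∈ Set.Icc lo hi, ∀ s ∈ Set.Icc lo hi, |s - t₀| ≤ τ →
        -(η * |s - t₀|) ≤ pc s - pc t₀ + a (pc t₀) t₀ * (s - t₀)) :
    ∀ (Θ : ℕ → ℝ → ℝ → ℝ) (pc : ℝ → ℝ) (a : ℝ → ℝ → ℝ) (lo hi ρ : ℝ),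
      0 < lo → lo < hi → hi < 1 → 0 < ρ →
      (∀ n, ContDiffOn ℝ 1 (fun x : ℝ × ℝ => Θ n x.1 x.2) (Set.Ioo 0 1 ×ˢ Set.Ioo 0 1)) →
      (∀ n t, Monotone (fun p => Θ n p t)) →
      (∀ p t, Antitone (fun n => Θ n p t)) →
      (∀ n p t, 0 ≤ Θ n p t) →
      ContinuousOn pc (Set.Icc lo hi) →
      (∀ t ∈ Set.Icc lo hi, ρ < pc t ∧ pc t + ρ < 1) →
      (∀ t ∈ Set.Icc lo hi, ∀ p : ℝ,
          (p < pc t → (⨅ n, Θ n p t) = 0) ∧ (pc t < p → 0 < ⨅ n, Θ n p t)) →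
      ContinuousOn (fun x : ℝ × ℝ => a x.1 x.2)
          {x : ℝ × ℝ | x.2 ∈ Set.Icc lo hi ∧ |x.1 - pc x.2| ≤ ρ} →
      (∀ η > (0 : ℝ), ∃ δ > (0 : ℝ), ∃ m : ℕ, ∀ n ≥ m, ∀ t ∈ Set.Icc lo hi, ∀ p : ℝ,
          pc t - δ ≤ p → p ≤ pc t + ρ →
          |deriv (fun s => Θ n p s) t - a p t * deriv (fun q => Θ n q t) p|
            ≤ η * deriv (fun q => Θ n q t) p) →
      ∀ t ∈ Set.Icc lo hi, HasDerivWithinAt pc (-(a (pc t) t)) (Set.Icc lo hi) t := by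
  intro Θ pc a lo hi ρ hlo hlohi hhi hρ hC1 hmp hanti hnn hpc hcollar hthr ha hex t ht
  obtain ⟨⟨A, hA⟩, hω⟩ := collar_moduli pc a lo hi ρ hpc ha
  have hτ := pc_modulus pc lo hi hpc
  have hUp := hU Θ pc a lo hi ρ A hlo hlohi hhi hρ hC1 hmp hanti hnn hcollar hthr hA hω hτ hex
  have hDown := hLo Θ pc a lo hi ρ A hlo hlohi hhi hρ hC1 hmp hanti hnn hcollar hthr hA hω hτ hex
  apply hasDerivWithinAt_of_cone pc (Set.Icc lo hi) t (-(a (pc t) t))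
  intro η hη
  obtain ⟨τ₁, hτ₁, h₁⟩ := hUp η hη
  obtain ⟨τ₂, hτ₂, h₂⟩ := hDown η hη
  refine ⟨min τ₁ τ₂, lt_min hτ₁ hτ₂, fun s hs hst => ?_⟩
  have e : pc s - pc t - (-(a (pc t) t)) * (s - t) = pc s - pc t + a (pc t) t * (s - t) := by ring
  rw [e, abs_le]
  exact ⟨h₂ t ht s hs (hst.trans (min_le_right _ _)), h₁ t ht s hs (hst.trans (min_le_left _ _))⟩

/-! ## §6  Right-continuity and the assembly (verbatim from `Lines/birth.lean`) -/

/-- Right-continuity of the infimum level function `q ↦ ⨅ n, Θ n q t` at interior points: an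
infimum of continuous nondecreasing functions is upper semicontinuous and nondecreasing, hence
right-continuous. (Proved in `Lines/birth.lean`; reproduced.) -/
theorem rightContinuity (Θ : ℕ → ℝ → ℝ → ℝ) (t : ℝ)
    (hcont : ∀ n, ContinuousOn (fun x : ℝ × ℝ => Θ n x.1 x.2) (Set.Ioo 0 1 ×ˢ Set.Ioo 0 1))
    (hmp : ∀ n t, Monotone (fun p => Θ n p t))
    (hnn : ∀ n p t, 0 ≤ Θ n p t)
    (ht : t ∈ Set.Ioo (0 : ℝ) 1) :
    ∀ p ∈ Set.Ioo (0 : ℝ) 1,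
      Tendsto (fun q => ⨅ n, Θ n q t) (𝓝[>] p) (𝓝 (⨅ n, Θ n p t)) := by
  intro p hp
  have bdd : ∀ q : ℝ, BddBelow (Set.range fun n => Θ n q t) := fun q =>
    ⟨0, by rintro _ ⟨n, rfl⟩; exact hnn n q t⟩
  have hmonoF : ∀ q r : ℝ, q ≤ r → (⨅ n, Θ n q t) ≤ ⨅ n, Θ n r t := fun q r hqr =>
    ciInf_mono (bdd q) fun n => hmp n t hqr
  rw [tendsto_order]
  refine ⟨fun b hb => ?_, fun b hb => ?_⟩
  · exact Filter.eventually_of_mem self_mem_nhdsWithin fun q hq =>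
      lt_of_lt_of_le hb (hmonoF p q (le_of_lt hq))
  · obtain ⟨n₀, hn₀⟩ := exists_lt_of_ciInf_lt hb
    have hc : ContinuousAt (fun x : ℝ × ℝ => Θ n₀ x.1 x.2) (p, t) :=
      (hcont n₀).continuousAt (IsOpen.mem_nhds (isOpen_Ioo.prod isOpen_Ioo) ⟨hp, ht⟩)
    have hc' : ContinuousAt (fun q : ℝ => Θ n₀ q t) p :=
      ContinuousAt.comp (g := fun x : ℝ × ℝ => Θ n₀ x.1 x.2) (f := fun q : ℝ => (q, t)) hc
        (by fun_prop : Continuous fun q : ℝ => (q, t)).continuousAt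
    have hev : ∀ᶠ q in 𝓝 p, Θ n₀ q t < b := (tendsto_order.1 hc'.tendsto).2 b hn₀
    have hev' : ∀ᶠ q in 𝓝[>] p, Θ n₀ q t < b := hev.filter_mono nhdsWithin_le_nhds
    exact hev'.mono fun q hq => lt_of_le_of_lt (ciInf_le (bdd q) n₀) hq

/-- **Assembly** (proved in `Lines/birth.lean`; reproduced verbatim): the pinching statement and
the level-transport statement imply the crux statement (the body of `TransportLemma`). -/
theorem TransportLemma_of_stubs
    (hPinch : ∀ (Θ : ℕ → ℝ → ℝ → ℝ) (pc : ℝ → ℝ) (a : ℝ → ℝ → ℝ) (lo hi ρ : ℝ),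
      0 < lo → lo < hi → hi < 1 → 0 < ρ →
      (∀ n, ContDiffOn ℝ 1 (fun x : ℝ × ℝ => Θ n x.1 x.2) (Set.Ioo 0 1 ×ˢ Set.Ioo 0 1)) →
      (∀ n t, Monotone (fun p => Θ n p t)) →
      (∀ p t, Antitone (fun n => Θ n p t)) →
      (∀ n p t, 0 ≤ Θ n p t) →
      ContinuousOn pc (Set.Icc lo hi) →
      (∀ t ∈ Set.Icc lo hi, ρ < pc t ∧ pc t + ρ < 1) →
      (∀ t ∈ Set.Icc lo hi, ∀ p : ℝ,
          (p < pc t → (⨅ n, Θ n p t) = 0) ∧ (pc t < p → 0 < ⨅ n, Θ n p t)) →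
      ContinuousOn (fun x : ℝ × ℝ => a x.1 x.2)
          {x : ℝ × ℝ | x.2 ∈ Set.Icc lo hi ∧ |x.1 - pc x.2| ≤ ρ} →
      (∀ η > (0 : ℝ), ∃ δ > (0 : ℝ), ∃ m : ℕ, ∀ n ≥ m, ∀ t ∈ Set.Icc lo hi, ∀ p : ℝ,
          pc t - δ ≤ p → p ≤ pc t + ρ →
          |deriv (fun s => Θ n p s) t - a p t * deriv (fun q => Θ n q t) p|
            ≤ η * deriv (fun q => Θ n q t) p) →
      ∀ t ∈ Set.Icc lo hi, HasDerivWithinAt pc (-(a (pc t) t)) (Set.Icc lo hi) t)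
    (hTrans : ∀ (Θ : ℕ → ℝ → ℝ → ℝ) (pc : ℝ → ℝ) (a : ℝ → ℝ → ℝ) (lo hi ρ L : ℝ),
      0 < lo → lo < hi → hi < 1 → 0 < ρ →
      (∀ n, ContDiffOn ℝ 1 (fun x : ℝ × ℝ => Θ n x.1 x.2) (Set.Ioo 0 1 ×ˢ Set.Ioo 0 1)) →
      (∀ n t, Monotone (fun p => Θ n p t)) →
      (∀ p t, Antitone (fun n => Θ n p t)) →
      (∀ n p t, 0 ≤ Θ n p t) →
      ContinuousOn pc (Set.Icc lo hi) →
      (∀ t ∈ Set.Icc lo hi, ρ < pc t ∧ pc t + ρ < 1) →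
      ContinuousOn (fun x : ℝ × ℝ => a x.1 x.2)
          {x : ℝ × ℝ | x.2 ∈ Set.Icc lo hi ∧ pc x.2 ≤ x.1 ∧ x.1 ≤ pc x.2 + ρ} →
      (∀ t ∈ Set.Icc lo hi, ∀ p q : ℝ, pc t ≤ p → p ≤ pc t + ρ → pc t ≤ q → q ≤ pc t + ρ →
          |a p t - a q t| ≤ L * |p - q|) →
      (∀ η > (0 : ℝ), ∃ m : ℕ, ∀ n ≥ m, ∀ t ∈ Set.Icc lo hi, ∀ p : ℝ,
          pc t ≤ p → p ≤ pc t + ρ →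
          |deriv (fun s => Θ n p s) t - a p t * deriv (fun q => Θ n q t) p|
            ≤ η * deriv (fun q => Θ n q t) p) →
      (∀ t ∈ Set.Icc lo hi, HasDerivWithinAt pc (-(a (pc t) t)) (Set.Icc lo hi) t) →
      ∀ t₀ t₁ : ℝ, lo ≤ t₀ → t₀ ≤ t₁ → t₁ ≤ hi →
        ∃ ε₀ > (0 : ℝ), ∀ ε : ℝ, 0 < ε → ε < ε₀ →
          (⨅ n, Θ n (pc t₁) t₁) ≤ (⨅ n, Θ n (pc t₀ + ε) t₀) ∧
          (⨅ n, Θ n (pc t₀) t₀) ≤ (⨅ n, Θ n (pc t₁ + ε) t₁)) :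
    ∀ (Θ : ℕ → ℝ → ℝ → ℝ) (pc : ℝ → ℝ) (a : ℝ → ℝ → ℝ) (lo hi ρ L : ℝ), 0 < lo → lo < hi → hi < 1 →
      0 < ρ → (∀ n, ContDiffOn ℝ 1 (fun x : ℝ × ℝ => Θ n x.1 x.2) (Set.Ioo 0 1 ×ˢ Set.Ioo 0 1)) →
      (∀ n t, Monotone (fun p => Θ n p t)) → (∀ n p, Monotone (fun t => Θ n p t)) →
      (∀ p t, Antitone (fun n => Θ n p t)) → (∀ n p t, 0 ≤ Θ n p t) →
      ContinuousOn pc (Set.Icc lo hi) → (∀ t ∈ Set.Icc lo hi, ρ < pc t ∧ pc t + ρ < 1) →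
      (∀ t ∈ Set.Icc lo hi, ∀ p : ℝ,
          (p < pc t → (⨅ n, Θ n p t) = 0) ∧ (pc t < p → 0 < ⨅ n, Θ n p t)) →
      ContinuousOn (fun x : ℝ × ℝ => a x.1 x.2)
          {x : ℝ × ℝ | x.2 ∈ Set.Icc lo hi ∧ |x.1 - pc x.2| ≤ ρ} →
      (∀ t ∈ Set.Icc lo hi, ∀ p q : ℝ, pc t ≤ p → p ≤ pc t + ρ → pc t ≤ q → q ≤ pc t + ρ →
          |a p t - a q t| ≤ L * |p - q|) →
      (∀ η > (0 : ℝ), ∃ δ > (0 : ℝ), ∃ m : ℕ, ∀ n ≥ m, ∀ t ∈ Set.Icc lo hi, ∀ p : ℝ,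
          pc t - δ ≤ p → p ≤ pc t + ρ →
          |deriv (fun s => Θ n p s) t - a p t * deriv (fun q => Θ n q t) p|
            ≤ η * deriv (fun q => Θ n q t) p) →
      ∀ t ∈ Set.Icc lo hi, (⨅ n, Θ n (pc t) t) = ⨅ n, Θ n (pc hi) hi := by
  intro Θ pc a lo hi ρ L hlo hlohi hhi hρ hC1 hmp hmt hanti hnn hpc hcollar hthr ha hL hex t ht
  -- (1) pinching: the curve is a characteristic of the field `a`
  have hchar : ∀ s ∈ Set.Icc lo hi, HasDerivWithinAt pc (-(a (pc s) s)) (Set.Icc lo hi) s :=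
    hPinch Θ pc a lo hi ρ hlo hlohi hhi hρ hC1 hmp hanti hnn hpc hcollar hthr ha hex
  -- (2) the transport step only needs the right closed collar
  have ha' : ContinuousOn (fun x : ℝ × ℝ => a x.1 x.2)
      {x : ℝ × ℝ | x.2 ∈ Set.Icc lo hi ∧ pc x.2 ≤ x.1 ∧ x.1 ≤ pc x.2 + ρ} := by
    refine ha.mono ?_
    rintro ⟨q, s⟩ ⟨hs, h1, h2⟩
    refine ⟨hs, ?_⟩
    rw [abs_le]
    constructor <;> linarith
  have hex' : ∀ η > (0 : ℝ), ∃ m : ℕ, ∀ n ≥ m, ∀ s ∈ Set.Icc lo hi, ∀ p : ℝ,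
      pc s ≤ p → p ≤ pc s + ρ →
      |deriv (fun r => Θ n p r) s - a p s * deriv (fun q => Θ n q s) p|
        ≤ η * deriv (fun q => Θ n q s) p := by
    intro η hη
    obtain ⟨δ, hδ, m, hm⟩ := hex η hη
    exact ⟨m, fun n hn s hs p h1 h2 => hm n hn s hs p (by linarith) h2⟩
  have hTr := hTrans Θ pc a lo hi ρ L hlo hlohi hhi hρ hC1 hmp hanti hnn hpc hcollar ha' hL hex' hchar
  -- (3) right-continuity of the level function at the curve
  have hcont : ∀ n, ContinuousOn (fun x : ℝ × ℝ => Θ n x.1 x.2) (Set.Ioo 0 1 ×ˢ Set.Ioo 0 1) :=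
    fun n => (hC1 n).continuousOn
  have hR : ∀ s ∈ Set.Icc lo hi,
      Tendsto (fun q => ⨅ n, Θ n q s) (𝓝[>] (pc s)) (𝓝 (⨅ n, Θ n (pc s) s)) := by
    intro s hs
    have hs' : s ∈ Set.Ioo (0 : ℝ) 1 := ⟨by linarith [hs.1], by linarith [hs.2]⟩
    have hpcs : pc s ∈ Set.Ioo (0 : ℝ) 1 := by
      obtain ⟨h1, h2⟩ := hcollar s hs
      exact ⟨by linarith, by linarith⟩
    exact rightContinuity Θ s hcont hmp hnn hs' (pc s) hpcs
  -- (4) compare the levels at `t` and at `hi`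
  have hhi' : hi ∈ Set.Icc lo hi := ⟨hlohi.le, le_rfl⟩
  obtain ⟨ε₀, hε₀, hε⟩ := hTr t hi ht.1 ht.2 le_rfl
  apply le_antisymm
  · refine ge_of_tendsto (hR hi hhi') ?_
    refine Filter.eventually_of_mem (Ioo_mem_nhdsGT (show pc hi < pc hi + ε₀ by linarith)) ?_
    intro q hq
    have h := (hε (q - pc hi) (by linarith [hq.1]) (by linarith [hq.2])).2
    have e : pc hi + (q - pc hi) = q := by ring
    rw [e] at h
    exact h
  · refine ge_of_tendsto (hR t ht) ?_
    refine Filter.eventually_of_mem (Ioo_mem_nhdsGT (show pc t < pc t + ε₀ by linarith)) ?_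
    intro q hq
    have h := (hε (q - pc t) (by linarith [hq.1]) (by linarith [hq.2])).1
    have e : pc t + (q - pc t) = q := by ring
    rw [e] at h
    exact h

/-- **The two stub STATEMENTS imply the crux** (sorry-free): fences ⇒ characteristic (§5) and the
proved level transport (§4) feed the assembly (§6). -/
theorem TransportLemma_of_fences
    (hU : ∀ (Θ : ℕ → ℝ → ℝ → ℝ) (pc : ℝ → ℝ) (a : ℝ → ℝ → ℝ) (lo hi ρ A : ℝ),
      0 < lo → lo < hi → hi < 1 → 0 < ρ →
      (∀ n, ContDiffOn ℝ 1 (fun x : ℝ × ℝ => Θ n x.1 x.2) (Set.Ioo 0 1 ×ˢ Set.Ioo 0 1)) →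
      (∀ n t, Monotone (fun p => Θ n p t)) →
      (∀ p t, Antitone (fun n => Θ n p t)) →
      (∀ n p t, 0 ≤ Θ n p t) →
      (∀ t ∈ Set.Icc lo hi, ρ < pc t ∧ pc t + ρ < 1) →
      (∀ t ∈ Set.Icc lo hi, ∀ p : ℝ,
          (p < pc t → (⨅ n, Θ n p t) = 0) ∧ (pc t < p → 0 < ⨅ n, Θ n p t)) →
      (∀ t ∈ Set.Icc lo hi, ∀ p : ℝ, |p - pc t| ≤ ρ → |a p t| ≤ A) →
      (∀ η > (0 : ℝ), ∃ ω > (0 : ℝ), ∀ t ∈ Set.Icc lo hi, ∀ t' ∈ Set.Icc lo hi, ∀ p p' : ℝ,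
          |p - pc t| ≤ ρ → |p' - pc t'| ≤ ρ → |t - t'| ≤ ω → |p - p'| ≤ ω →
          |a p t - a p' t'| ≤ η) →
      (∀ κ > (0 : ℝ), ∃ τ > (0 : ℝ), ∀ t ∈ Set.Icc lo hi, ∀ t' ∈ Set.Icc lo hi,
          |t - t'| ≤ τ → |pc t - pc t'| ≤ κ) →
      (∀ η > (0 : ℝ), ∃ δ > (0 : ℝ), ∃ m : ℕ, ∀ n ≥ m, ∀ t ∈ Set.Icc lo hi, ∀ p : ℝ,
          pc t - δ ≤ p → p ≤ pc t + ρ →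
          |deriv (fun s => Θ n p s) t - a p t * deriv (fun q => Θ n q t) p|
            ≤ η * deriv (fun q => Θ n q t) p) →
      ∀ η > (0 : ℝ), ∃ τ > (0 : ℝ), ∀ t₀ ∈ Set.Icc lo hi, ∀ s ∈ Set.Icc lo hi, |s - t₀| ≤ τ →
        pc s - pc t₀ + a (pc t₀) t₀ * (s - t₀) ≤ η * |s - t₀|)
    (hLo : ∀ (Θ : ℕ → ℝ → ℝ → ℝ) (pc : ℝ → ℝ) (a : ℝ → ℝ → ℝ) (lo hi ρ A : ℝ),
      0 < lo → lo < hi → hi < 1 → 0 < ρ →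
      (∀ n, ContDiffOn ℝ 1 (fun x : ℝ × ℝ => Θ n x.1 x.2) (Set.Ioo 0 1 ×ˢ Set.Ioo 0 1)) →
      (∀ n t, Monotone (fun p => Θ n p t)) →
      (∀ p t, Antitone (fun n => Θ n p t)) →
      (∀ n p t, 0 ≤ Θ n p t) →
      (∀ t ∈ Set.Icc lo hi, ρ < pc t ∧ pc t + ρ < 1) →
      (∀ t ∈ Set.Icc lo hi, ∀ p : ℝ,
          (p < pc t → (⨅ n, Θ n p t) = 0) ∧ (pc t < p → 0 < ⨅ n, Θ n p t)) →
      (∀ t ∈ Set.Icc lo hi, ∀ p : ℝ, |p - pc t| ≤ ρ → |a p t| ≤ A) →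
      (∀ η > (0 : ℝ), ∃ ω > (0 : ℝ), ∀ t ∈ Set.Icc lo hi, ∀ t' ∈ Set.Icc lo hi, ∀ p p' : ℝ,
          |p - pc t| ≤ ρ → |p' - pc t'| ≤ ρ → |t - t'| ≤ ω → |p - p'| ≤ ω →
          |a p t - a p' t'| ≤ η) →
      (∀ κ > (0 : ℝ), ∃ τ > (0 : ℝ), ∀ t ∈ Set.Icc lo hi, ∀ t' ∈ Set.Icc lo hi,
          |t - t'| ≤ τ → |pc t - pc t'| ≤ κ) →
      (∀ η > (0 : ℝ), ∃ δ > (0 : ℝ), ∃ m : ℕ, ∀ n ≥ m, ∀ t ∈ Set.Icc lo hi, ∀ p : ℝ,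
          pc t - δ ≤ p → p ≤ pc t + ρ →
          |deriv (fun s => Θ n p s) t - a p t * deriv (fun q => Θ n q t) p|
            ≤ η * deriv (fun q => Θ n q t) p) →
      ∀ η > (0 : ℝ), ∃ τ > (0 : ℝ), ∀ t₀ ∈ Set.Icc lo hi, ∀ s ∈ Set.Icc lo hi, |s - t₀| ≤ τ →
        -(η * |s - t₀|) ≤ pc s - pc t₀ + a (pc t₀) t₀ * (s - t₀)) :
    Summit.CriticalPhenomena.PercolationContinuityZ3.Theses.PercExchangeRateTransport.TransportLemma :=
  TransportLemma_of_stubs (curveIsCharacteristic_of_fences hU hLo) levelTransport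

/-- **THE SKELETON THEOREM (registrar shape).** The crux
`Summit.CriticalPhenomena.PercolationContinuityZ3.Theses.PercExchangeRateTransport.TransportLemma`,
concluded BY NAME from the two declared stubs through the sorry-free composition
`TransportLemma_of_fences`; rev 2: both stubs are proved, so the closure contains NO `sorry`. -/
theorem TransportLemma_of :
    Summit.CriticalPhenomena.PercolationContinuityZ3.Theses.PercExchangeRateTransport.TransportLemma :=
  TransportLemma_of_fences stub_upperFence stub_lowerFence

end Summit.CriticalPhenomena.PercolationContinuityZ3.Cruxes.TransportLemma.Corrector
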